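import Mathlib
import Summits.ResolutionOfSingularities.ResolutionOfSingularities.Theorems.HomologicalConductorSurfaceTerminationCubicTriangleExit
import HarnessLib

/-!
# Kill test `SurfaceTermination` (stmt-ResolutionOfSingularities-16488) — the decided class «cubics through the
# coordinate triangle» stated INSIDE the hypothesis format of the uniform (R-QH) target `SurfaceTerminationQH`

OURS (cell res-hironaka, crux chain W4.4, seat res-D-pv-045 gen 8; CHAIN v29 row «first consumer of the (R-QH)
typed target», gap object 2026-08-27T19:53Z); nothing here is a statement of the manuscript under review
(Hironaka 2017); AI-written, weaker than expert review.  SUPPORT-level, counted 0.  Def-free, fact-free.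

The lead's typed target `SurfaceTermination.RQH.SurfaceTerminationQH` (p550176, `…SurfaceTerminationRQHDefs`)
quantifies over weighted-homogeneous presentations `g : Fin n → K`, `w : Fin n → ℕ` of a two-dimensional graded
domain with its WEIGHT valuation ring `O` ((qh1) `hhom`, (qh2) `hval`, (qh3) `hg`).  The (R-QH) pieces landed so
far (`…CubicTriangleExit`, p555888: every cubic `f_a` through the coordinate triangle with `a₀a₂ ≠ 0`, over every
field) are phrased with the cubic files' own weight hypothesis
`hW : v(F(x,y,z)) = v(x)^d` for homogeneous `F` of degree `d` with `F(x,y,z) ≠ 0`.  This file is the dictionary: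

* `valuation_aeval_eq_pow_of_weightLaw` — for ALL-ONE weights, (qh2) `hval` at `G := X i` with `g i ≠ 0` IS the
  cubic files' `hW` (`IsHomogeneous = IsWeightedHomogeneous 1`);
* `apply_zero_ne_zero_of_ker_eq_span` — `x = g 0 ≠ 0` whenever the presentation ideal is generated by one
  form of degree `≥ 2` (degree count: `X 0 ∉ (f)`);
* **`exists_isRegularLocalRing_tower_of_qh_cubicTriangle`** — the LITERAL binder list of `SurfaceTerminationQH`
  at `n = 3` (p, k, K, O, g, w, hw, hk, hfr, hdim, hhom, hval, hg) plus the class data «`w = 1`, kernel `(f_a)`,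
  `a₀ ≠ 0`, `a₂ ≠ 0`» ⊢ `∃ m, IsRegularLocalRing (tower O (aeval g).range m)`: the q.h. class decided by
  p555888, now consumable in the target's own currency (a BC5-style instance INSIDE (R-QH), not a closer).

References: S. B. Iyengar, R. Takahashi, *IMRN* 2016 [`IyengarTakahashi2014`] (the `ca` of the tower); this cell's
(R-QH) files p543906–p556959 (OURS).
-/

noncomputable section

-- single-problem summit: the doubled namespace component `ResolutionOfSingularities` is forced
set_option linter.dupNamespace false

namespace Summit.ResolutionOfSingularities.ResolutionOfSingularities.Theorems.SurfaceTermination.CubicTriangle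

open MvPolynomial
open Summit.ResolutionOfSingularities.ResolutionOfSingularities.Theorems.NoZeno.Birth

variable {k K : Type} [Field k] [Field K] [Algebra k K]

/-- **(qh2) at all-one weights is the weight law of the cubic files.**  If for all weighted-homogeneous
`F`, `G` (weights `1`) with non-zero values `v(F)^{deg G} = v(G)^{deg F}`, then for `g i ≠ 0` and `F`
homogeneous of degree `d` with `F(g) ≠ 0`: `v(F(g)) = v(g i)^d` (take `G := X i`). [folklore] -/
theorem valuation_aeval_eq_pow_of_weightLaw (O : ValuationSubring K) {n : ℕ} (g : Fin n → K)
    (hval : ∀ (d e : ℕ) (F G : MvPolynomial (Fin n) k), IsWeightedHomogeneous (1 : Fin n → ℕ) F d →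
      IsWeightedHomogeneous (1 : Fin n → ℕ) G e → aeval g F ≠ 0 → aeval g G ≠ 0 →
      O.valuation (aeval g F) ^ e = O.valuation (aeval g G) ^ d)
    (i : Fin n) (hi : g i ≠ 0) (d : ℕ) (F : MvPolynomial (Fin n) k) (hF : F.IsHomogeneous d)
    (hF0 : aeval g F ≠ 0) : O.valuation (aeval g F) = O.valuation (g i) ^ d := by
  have hX : aeval g (X i : MvPolynomial (Fin n) k) = g i := aeval_X g i
  have h := hval d 1 F (X i) hF (isHomogeneous_X k i) hF0 (by rw [hX]; exact hi)
  rwa [pow_one, hX] at h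

/-- **The first coordinate is non-zero** when the presentation ideal of `g : Fin (n+1) → K` is generated by ONE
form `f` of degree `≥ 2`: otherwise `X 0 ∈ ker = (f)`, and a non-zero multiple of `f` has total degree `≥ 2 > 1`.
[folklore] -/
theorem apply_zero_ne_zero_of_ker_eq_span {n : ℕ} (g : Fin (n + 1) → K) {f : MvPolynomial (Fin (n + 1)) k}
    {d : ℕ} (hf : f.IsHomogeneous d) (hf0 : f ≠ 0) (hd : 2 ≤ d)
    (hker : RingHom.ker (MvPolynomial.aeval (R := k) g).toRingHom = Ideal.span {f}) : g 0 ≠ 0 := by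
  intro h0
  have hmem : (X 0 : MvPolynomial (Fin (n + 1)) k) ∈ RingHom.ker (MvPolynomial.aeval (R := k) g).toRingHom := by
    rw [RingHom.mem_ker]
    change aeval g (X 0 : MvPolynomial (Fin (n + 1)) k) = 0
    rw [aeval_X, h0]
  rw [hker, Ideal.mem_span_singleton] at hmem
  obtain ⟨q, hq⟩ := hmem
  have hq0 : q ≠ 0 := by
    rintro rfl
    rw [mul_zero] at hq
    exact X_ne_zero (R := k) (0 : Fin (n + 1)) hq
  have hdeg := congrArg totalDegree hq
  rw [totalDegree_X, totalDegree_mul_of_isDomain hf0 hq0, hf.totalDegree hf0] at hdeg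
  omega

/-- **The q.h. class «cubics through the coordinate triangle» in (R-QH) currency.**  With the LITERAL hypothesis
list of the uniform target `SurfaceTerminationQH` (p550176) at `n = 3` — prime `p`, `CharP k p`, a valuation ring
`O ∋ k` of `K`, a presentation `g : Fin 3 → K` with weights `w`, `Frac (k[g]) = K`, `dim k[g] = 2`, (qh1) `hhom`,
(qh2) `hval`, (qh3) `hg` — and the class data `w = 1`, `ker (aeval g) = (f_a)` for the cubic
`f_a = a₀X₀²X₁ + a₁X₀²X₂ + a₂X₁²X₂ + a₃X₁²X₀ + a₄X₂²X₀ + a₅X₂²X₁ + a₆X₀X₁X₂` with `a₀ ≠ 0`, `a₂ ≠ 0`: SOME STAGE OF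
THE ca-TOWER `tower O k[g] m` IS REGULAR (`CubicTriangle.exists_isRegularLocalRing_tower_cubicTriangle`, p555888).
[cite: IyengarTakahashi2014, Definition 2.1] -/
theorem exists_isRegularLocalRing_tower_of_qh_cubicTriangle (p : ℕ) (hp : p.Prime) [CharP k p]
    (O : ValuationSubring K) (g : Fin 3 → K) (w : Fin 3 → ℕ) (_hw : ∀ i, 0 < w i)
    (hk : ∀ c : k, algebraMap k K c ∈ O)
    (hfr : IsFractionRing ↥(MvPolynomial.aeval (R := k) g).range K)
    (hdim : ringKrullDim ↥(MvPolynomial.aeval (R := k) g).range = 2)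
    (_hhom : ∀ F : MvPolynomial (Fin 3) k, MvPolynomial.aeval g F = 0 →
      ∀ m : ℕ, MvPolynomial.aeval g (MvPolynomial.weightedHomogeneousComponent w m F) = 0)
    (hval : ∀ (d e : ℕ) (F G : MvPolynomial (Fin 3) k), MvPolynomial.IsWeightedHomogeneous w F d →
      MvPolynomial.IsWeightedHomogeneous w G e → MvPolynomial.aeval g F ≠ 0 → MvPolynomial.aeval g G ≠ 0 →
      O.valuation (MvPolynomial.aeval g F) ^ e = O.valuation (MvPolynomial.aeval g G) ^ d)
    (hg : ∀ i, O.valuation (g i) < 1)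
    (hw1 : ∀ i, w i = 1) (a : Fin 7 → k) (h0 : a 0 ≠ 0) (h2 : a 2 ≠ 0)
    (hker : RingHom.ker (MvPolynomial.aeval (R := k) g).toRingHom =
      Ideal.span {C (a 0) * (X 0 ^ 2 * X 1) + C (a 1) * (X 0 ^ 2 * X 2) + C (a 2) * (X 1 ^ 2 * X 2) +
        C (a 3) * (X 1 ^ 2 * X 0) + C (a 4) * (X 2 ^ 2 * X 0) + C (a 5) * (X 2 ^ 2 * X 1) + C (a 6) * (X 0 * X 1 * X 2)}) :
    ∃ m : ℕ, IsRegularLocalRing ↥(tower O (MvPolynomial.aeval (R := k) g).range m) := by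
  -- all weights are one
  obtain rfl : w = 1 := funext hw1
  -- the presentation is `![x, y, z]`
  obtain ⟨x, y, z, rfl⟩ : ∃ x y z : K, g = ![x, y, z] := ⟨g 0, g 1, g 2, by ext i; fin_cases i <;> rfl⟩
  -- `x ≠ 0` (the kernel is generated by a cubic form)
  have hx0 : x ≠ 0 :=
    apply_zero_ne_zero_of_ker_eq_span (k := k) ![x, y, z] (isHomogeneous_cubicTriangle a)
      (cubicTriangle_ne_zero a h0) (by norm_num) hker
  -- the weight law of the cubic files from (qh2)
  have hW : ∀ (d : ℕ) (F : MvPolynomial (Fin 3) k), F.IsHomogeneous d → MvPolynomial.aeval ![x, y, z] F ≠ 0 →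
      O.valuation (MvPolynomial.aeval ![x, y, z] F) = O.valuation x ^ d := fun d F hF hF0 =>
    valuation_aeval_eq_pow_of_weightLaw (k := k) O ![x, y, z] hval 0 hx0 d F hF hF0
  exact exists_isRegularLocalRing_tower_cubicTriangle (hker := hker) (hW := hW) (hx := hg 0) (hk := hk) h0 h2 p
    hp hfr hdim

end Summit.ResolutionOfSingularities.ResolutionOfSingularities.Theorems.SurfaceTermination.CubicTriangle

end
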